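/-
HONEST FRAMING: certified error envelopes and provably optimal rounding/accumulation schemes for
low-precision formats under stated cost models; every table by two implementations; no hardware
or vendor claims.
-/
import Summits.Ventures.CertifiedArithmetic.LowPrec.OptDemotionRoutingR33Arith
import Summits.Ventures.CertifiedArithmetic.LowPrec.OptDemotionRoutingPhi3Arith
import Summits.Ventures.CertifiedArithmetic.LowPrec.OptDemotionRoutingPhi3pArith
import Mathlib.Tactic.FieldSimp
import Mathlib.Tactic.Positivity

/-!
# The demotion law (Theorem T8), part 11-3: the eight branch certificates of the Φ-hierarchy in UN-NORMALISED coordinates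

Part 11 (E-SIDE-TOPLEVEL.md: every top-level e-side row `E(P)` and every auxiliary row `Φ(P; j)`,
all popcounts, all `q`) runs the node step on un-normalised integer configurations
(`{-1} ∪ K`, `{0} ∪ K`, `{-q} ∪ K`, `{-1-q} ∪ C`, … with `C = S ∖ K` carrying all passive bits), in
which the scale factors `2^-cm`, `2^-k₁`, `2^-p₁` of the normalised coordinates of parts 10i–10l are
absorbed into the atoms.  The eight pure-arithmetic branch lemmas below are the landed certificates
`eRow2_branch1..4` (part 10j-a), `phi3_branch1` (10i-a), `phi3p_branch0/K/L` (10k-a) after that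
substitution (every scale cancels; the free box variable is instantiated at `t/2`, `g` at `½` or `1`):
nothing new is certified here, the kernel re-checks the substitution.
* `E`-branches (goal `1 + (2A₁ + 2Y₁) ≤ (1-u) N_S + (1+u) N_R`, box `4u ≤ t ≤ ¼`, `t = 2^s₁`):
  `eRowU_all` (kept set `K = S`, IH), `eRowU_empty` (`K = ∅`, opt's L1), `eRowU_top` (`s₁ ∈ K`,
  `E(K)` + LEMMA B1 below the complement), `eRowU_low` (`s₁ ∉ K ≠ ∅`, `Φ(K; s₁)` + (MC)).
* `Φ`-branches (goal `1 + (2A₁ + 2Y₁) ≤ (1-u) N_S + N₂ + u N₃`, box `2u ≤ w`, `2w ≤ τ ≤ ¼`,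
  `w = 2^s₁`, `τ = 2^e`): `phiU_all`, `phiU_empty` (the one-regime hard branch), `phiU_top`
  (`Φ(K; e)` + B1), `phiU_low` (`Φ(K; s₁)` + B1).
-/

namespace Summit.Ventures.CertifiedArithmetic.LowPrec.Opt

/-! ## The four `E`-branches -/

/-- `E`, kept set `K = S`: option `2A₁ + u Z₀` (`A₁ = BR_X({-1} ∪ S)`, `Z₀ = BR_Y{0}`); options
`1 + A₀ + u Z₀ ≤ N_S`, `t + A_R + t u Z₀ ≤ N_R`; the induction hypothesis `2A₁ ≤ (1-u)A₀ + (1+u)A_R`. -/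
theorem eRowU_all {u t NS NR A1 A0 AR Z0 : ℚ} (hu0 : 0 < u) (ht : 4 * u ≤ t) (ht4 : t ≤ 1 / 4)
    (o1 : 1 + (A0 + u * Z0) ≤ NS) (o2 : t + (AR + t * u * Z0) ≤ NR)
    (ih : 0 ≤ -2 * A1 + (1 - u) * A0 + (1 + u) * AR) (hZ : 0 ≤ Z0) :
    1 + (2 * A1 + u * Z0) ≤ (1 - u) * NS + (1 + u) * NR := by
  have ht0 : 0 < t := by linarith
  have htne : t ≠ 0 := ht0.ne'
  have h := eRow2_branch4 (u := u) (m := t / 2) (t := t) (NJK := NS) (NR := NR / t) (T0a := 2 * A1)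
    (TJKa := A0) (TRa := AR / t) (Zb := Z0) hu0 (by linarith) (by linarith) ht4
    (by linarith only [o1]) ?_ ?_ hZ
  · have e : (t + u * t) * (NR / t) = (1 + u) * NR := by field_simp
    linarith only [h, e]
  · rw [le_div_iff₀ ht0]
    have e : (1 + ((1) * (AR / t) + (u) * Z0)) * t = t + (AR + t * u * Z0) := by field_simp
    rw [e]; exact o2
  · have e : (t + u * t) * (AR / t) = (1 + u) * AR := by field_simp
    linarith only [ih, e]

/-- `E`, kept set `K = ∅` (opt's L1): option `A₀₀ + 2 Y_{S1}` (`A₀₀ = BR_X{0}`,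
`Y_{S1} = BR_Y({-1-q} ∪ S)`); options `1 + A₀₀ + Y_{S0} ≤ N_S` (`Y_{S0} = BR_Y({-q} ∪ S)`),
`t + Y_S + u A_{0s} ≤ N_R` (`Y_S = BR_Y(S)`, `A_{0s} = BR_X{s₁, 0}`), `t + Y_{S0} + t u A₀₀ ≤ N_R`; rows
(M) `A₀₀ ≤ A_{0s}`, (MC) `2Y_{S1} ≤ Y_{S0} + Y_S`, (M) `Y_S ≤ Y_{S0}`. -/
theorem eRowU_empty {u t NS NR A00 A0s YS1 YS0 YS : ℚ} (hu0 : 0 < u) (ht : 4 * u ≤ t) (ht4 : t ≤ 1 / 4)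
    (o1 : 1 + (A00 + YS0) ≤ NS) (o2 : t + (YS + u * A0s) ≤ NR) (o3 : t + (YS0 + t * u * A00) ≤ NR)
    (rMa : 0 ≤ -A00 + A0s) (rMC : 0 ≤ -2 * YS1 + YS0 + YS) (rMb : 0 ≤ -YS + YS0) :
    1 + (A00 + 2 * YS1) ≤ (1 - u) * NS + (1 + u) * NR := by
  have ht0 : 0 < t := by linarith
  have htne : t ≠ 0 := ht0.ne'
  have h := eRow2_branch1 (u := u) (m := t / 2) (t := t) (NJK := NS) (NR := NR / t) (TR1b := YS1 / t)
    (TRb := YS0 / t) (XJa := A0s) (XKJb := YS / t) (Za := A00) hu0 (by linarith) (by linarith) ht4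
    ?_ ?_ ?_ (by linarith only [rMa]) ?_ ?_
  · have e1 : (t + u * t) * (NR / t) = (1 + u) * NR := by field_simp
    have e2 : 2 * t * (YS1 / t) = 2 * YS1 := by field_simp
    linarith only [h, e1, e2]
  · have e : (t) * (YS0 / t) = YS0 := by field_simp
    linarith only [o1, e]
  · have e1 : (t) * (YS / t) = YS := by field_simp
    have e2 : (t) * (NR / t) = NR := by field_simp
    linarith only [o2, e1, e2]
  · rw [le_div_iff₀ ht0]
    have e : (1 + ((1) * (YS0 / t) + (u) * A00)) * t = t + (YS0 + t * u * A00) := by field_simp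
    rw [e]; exact o3
  · rw [show (-2) * (YS1 / t) + (1) * (YS0 / t) + (1) * (YS / t) = (-2 * YS1 + YS0 + YS) / t by ring]
    exact div_nonneg rMC ht0.le
  · rw [show (-1) * (YS / t) + (1) * (YS0 / t) = (-YS + YS0) / t by ring]
    exact div_nonneg rMb ht0.le

/-- `E`, kept set `K ∋ s₁`, complement `C ≠ ∅` (opt's L2 with passive bits): option `2A₁ + 2Y₁`
(`A₁ = BR_X({-1} ∪ K)`, `Y₁ = BR_Y({-1-q} ∪ C)`); options `1 + A₀ + Y₀ ≤ N_S` (`A₀ = BR_X({0} ∪ K)`,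
`Y₀ = BR_Y({-q} ∪ C)`), `t + A_Q + Y_J ≤ N_R` (`A_Q = BR_X({-q} ∪ K)`, `Y_J = BR_Y({s₁-q} ∪ C)`);
rows `E(K)` on `X`, and on `Y` (MC) `2Y₁ ≤ Y₀ + Z` (`Z = BR_Y(C)`), gap convexity
`(2-2t) Y₁ ≤ Y_J + (1-2t) Y₀`, (M) `Z ≤ Y_J`. -/
theorem eRowU_top {u t NS NR A1 A0 AQ Y1 Y0 YJ Z : ℚ} (hu0 : 0 < u) (ht : 4 * u ≤ t) (ht4 : t ≤ 1 / 4)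
    (o1 : 1 + (A0 + Y0) ≤ NS) (o2 : t + (AQ + YJ) ≤ NR) (rE : 0 ≤ -2 * A1 + (1 - u) * A0 + (1 + u) * AQ)
    (rMC : 0 ≤ -2 * Y1 + Y0 + Z) (rGC : 0 ≤ (-2 + 2 * t) * Y1 + YJ + (1 - 2 * t) * Y0) (rM : 0 ≤ -Z + YJ) :
    1 + (2 * A1 + 2 * Y1) ≤ (1 - u) * NS + (1 + u) * NR := by
  have ht0 : 0 < t := by linarith
  have htne : t ≠ 0 := ht0.ne'
  have h := eRow2_branch2 (u := u) (m := t / 2) (t := t) (NJK := NS) (NR := NR / t) (XJ1a := 2 * A1)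
    (XJa := A0) (XQJa := AQ / t) (XQK1b := 2 * Y1 / t) (XQKJb := 2 * YJ / t) (XQKb := 2 * Y0 / t)
    (Zb := 2 * Z / t) hu0 (by linarith) (by linarith) ht4 ?_ ?_ ?_ ?_ ?_ ?_
  · have e1 : (t + u * t) * (NR / t) = (1 + u) * NR := by field_simp
    have e2 : 2 * (t / 2) * (2 * Y1 / t) = 2 * Y1 := by field_simp
    linarith only [h, e1, e2]
  · have e : (t / 2) * (2 * Y0 / t) = Y0 := by field_simp
    linarith only [o1, e]
  · have e1 : (t) * (AQ / t) = AQ := by field_simp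
    have e2 : (t / 2) * (2 * YJ / t) = YJ := by field_simp
    have e3 : (t) * (NR / t) = NR := by field_simp
    linarith only [o2, e1, e2, e3]
  · have e : (t + u * t) * (AQ / t) = (1 + u) * AQ := by field_simp
    linarith only [rE, e]
  · rw [show (-2) * (2 * Y1 / t) + (1) * (2 * Y0 / t) + (1) * (2 * Z / t) = 2 * (-2 * Y1 + Y0 + Z) / t by ring]
    exact div_nonneg (by linarith only [rMC]) ht0.le
  · rw [show (-2 * u + 2 * u * t) * (2 * Y1 / t) + (u) * (2 * YJ / t) + (u - 2 * u * t) * (2 * Y0 / t) =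
      2 * u * ((-2 + 2 * t) * Y1 + YJ + (1 - 2 * t) * Y0) / t by ring]
    exact div_nonneg (by nlinarith only [rGC, hu0]) ht0.le
  · rw [show (-1) * (2 * Z / t) + (1) * (2 * YJ / t) = 2 * (-Z + YJ) / t by ring]
    exact div_nonneg (by linarith only [rM]) ht0.le

/-- `E`, kept set `K` with `s₁ ∉ K ≠ ∅` (opt's L3 with passive bits): option `2A₁ + 2Y₁`; options
`1 + A₀ + Y₀ ≤ N_S`, `t + Z + A_P ≤ N_R` (`Z = BR_Y(C)`, `A_P = BR_X({s₁-q, -q} ∪ K)`),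
`t + Y₀ + A_J ≤ N_R` (`A_J = BR_X({s₁-q} ∪ K)`); rows `Φ(K; s₁)` on `X` and (MC) `2Y₁ ≤ Y₀ + Z` on `Y`. -/
theorem eRowU_low {u t NS NR A1 A0 AP AJ Y1 Y0 Z : ℚ} (hu0 : 0 < u) (ht : 4 * u ≤ t) (ht4 : t ≤ 1 / 4)
    (o1 : 1 + (A0 + Y0) ≤ NS) (o2 : t + (Z + AP) ≤ NR) (o3 : t + (Y0 + AJ) ≤ NR)
    (rPhi : 0 ≤ -2 * A1 + (1 - u) * A0 + AP + u * AJ) (rMC : 0 ≤ -2 * Y1 + Y0 + Z) :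
    1 + (2 * A1 + 2 * Y1) ≤ (1 - u) * NS + (1 + u) * NR := by
  have ht0 : 0 < t := by linarith
  have htne : t ≠ 0 := ht0.ne'
  have h := eRow2_branch3 (u := u) (m := t / 2) (t := t) (NJK := NS) (NR := NR / t) (XK1a := 2 * A1)
    (XKa := A0) (XPa := 2 * AP / t) (XQJ1b := Y1 / t) (XQJb := Y0 / t) (XQKJa := 2 * AJ / t)
    (Zb := Z / t) hu0 (by linarith) (by linarith) ht4 ?_ ?_ ?_ ?_ ?_
  · have e1 : (t + u * t) * (NR / t) = (1 + u) * NR := by field_simp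
    have e2 : 2 * t * (Y1 / t) = 2 * Y1 := by field_simp
    linarith only [h, e1, e2]
  · have e : (t) * (Y0 / t) = Y0 := by field_simp
    linarith only [o1, e]
  · have e1 : (t) * (Z / t) = Z := by field_simp
    have e2 : (t / 2) * (2 * AP / t) = AP := by field_simp
    have e3 : (t) * (NR / t) = NR := by field_simp
    linarith only [o2, e1, e2, e3]
  · have e1 : (t) * (Y0 / t) = Y0 := by field_simp
    have e2 : (t / 2) * (2 * AJ / t) = AJ := by field_simp
    have e3 : (t) * (NR / t) = NR := by field_simp
    linarith only [o3, e1, e2, e3]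
  · have e1 : (t / 2) * (2 * AP / t) = AP := by field_simp
    have e2 : (u * (t / 2)) * (2 * AJ / t) = u * AJ := by field_simp
    linarith only [rPhi, e1, e2]
  · rw [show (-2) * (Y1 / t) + (1) * (Y0 / t) + (1) * (Z / t) = (-2 * Y1 + Y0 + Z) / t by ring]
    exact div_nonneg rMC ht0.le

/-! ## The four `Φ`-branches -/

/-- `Φ`, kept set `K = S`: option `2A₁ + u Z₀`; options `1 + A₀ + u Z₀ ≤ N_S`, `w + A₂ + w u Z₀ ≤ N₂`
(`A₂ = BR_X({e-q, -q} ∪ S)`), `w + A₃ + w u Z₀ ≤ N₃` (`A₃ = BR_X({e-q} ∪ S)`); the induction hypothesis. -/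
theorem phiU_all {u w τ NS N2 N3 A1 A0 A2 A3 Z0 : ℚ} (hu0 : 0 < u) (hwu : 2 * u ≤ w) (hτw : 2 * w ≤ τ)
    (hτ4 : τ ≤ 1 / 4) (o1 : 1 + (A0 + u * Z0) ≤ NS) (o2 : w + (A2 + w * u * Z0) ≤ N2)
    (o3 : w + (A3 + w * u * Z0) ≤ N3) (ih : 0 ≤ -2 * A1 + (1 - u) * A0 + A2 + u * A3) (hZ : 0 ≤ Z0) :
    1 + (2 * A1 + u * Z0) ≤ (1 - u) * NS + N2 + u * N3 := by
  have hw0 : 0 < w := by linarith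
  have hwne : w ≠ 0 := hw0.ne'
  have h := phi3_branch1 (u := u) (m := w) (t := τ) (NK := NS) (NP := N2 / w) (NQ := N3 / w) (XK1a := 2 * A1)
    (XKa := A0) (XPa := A2 / w) (XQa := A3 / w) (Zb := Z0) hu0 hwu hτw hτ4 (by linarith only [o1]) ?_ ?_ ?_ hZ
  · have e1 : (w) * (N2 / w) = N2 := by field_simp
    have e2 : (u * w) * (N3 / w) = u * N3 := by field_simp
    linarith only [h, e1, e2]
  · rw [le_div_iff₀ hw0]
    have e : (1 + ((1) * (A2 / w) + (u) * Z0)) * w = w + (A2 + w * u * Z0) := by field_simp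
    rw [e]; exact o2
  · rw [le_div_iff₀ hw0]
    have e : (1 + ((1) * (A3 / w) + (u) * Z0)) * w = w + (A3 + w * u * Z0) := by field_simp
    rw [e]; exact o3
  · have e1 : (w) * (A2 / w) = A2 := by field_simp
    have e2 : (u * w) * (A3 / w) = u * A3 := by field_simp
    linarith only [ih, e1, e2]

/-- `Φ`, kept set `K = ∅` (the one-regime hard branch with passive bits): option `A₀₀ + 2Y_{S1}`;
options `1 + A₀₀ + Y_{Sq} ≤ N_S` (`Y_{Sq} = BR_Y({-q} ∪ S)`), `w + Y_S + u A_{JK} ≤ N₂`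
(`A_{JK} = BR_X{s₁, e, 0}`), `w + Y_{Se} + u A_{0s} ≤ N₂` (`Y_{Se} = BR_Y({e-q} ∪ S)`,
`A_{0s} = BR_X{s₁, 0}`), `w + Y_S + u τ A_{KJ} ≤ N₃` (`A_{KJ} = BR_X{s₁-e, 0}`); rows on `Y`: (MC)
`2Y_{S1} ≤ Y_{Sq} + Y_S`, gap convexity `(2-2τ) Y_{S1} ≤ Y_{Se} + (1-2τ) Y_{Sq}`; (M) on `X` twice. -/
theorem phiU_empty {u w τ NS N2 N3 A00 AJK A0s AKJ YS1 YSq YS YSe : ℚ} (hu0 : 0 < u) (hwu : 2 * u ≤ w)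
    (hτw : 2 * w ≤ τ) (hτ4 : τ ≤ 1 / 4) (o1 : 1 + (A00 + YSq) ≤ NS) (o2 : w + (YS + u * AJK) ≤ N2)
    (o3 : w + (YSe + u * A0s) ≤ N2) (o4 : w + (YS + u * τ * AKJ) ≤ N3) (rMC : 0 ≤ -2 * YS1 + YSq + YS)
    (rGC : 0 ≤ (-2 + 2 * τ) * YS1 + YSe + (1 - 2 * τ) * YSq) (rM1 : 0 ≤ -A00 + AJK) (rM2 : 0 ≤ -A00 + A0s)
    (hn : 0 ≤ AKJ) :
    1 + (A00 + 2 * YS1) ≤ (1 - u) * NS + N2 + u * N3 := by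
  have hw0 : 0 < w := by linarith
  have hwne : w ≠ 0 := hw0.ne'
  have h := phi3p_branch0 (u := u) (m := w) (t := τ) (NKL := NS) (NP3 := N2 / w) (NPJ := N3 / w) (TJKa := AJK)
    (TSCJb := YSe / w) (TSCb := YSq / w) (TSRb := YS1 / w) (XKJa := AKJ) (XKa := A0s) (XSb := YS / w) (Za := A00)
    hu0 hwu hτw hτ4 ?_ ?_ ?_ ?_ ?_ ?_ (by linarith only [rM1]) (by linarith only [rM2]) hn
  · have e1 : (w) * (N2 / w) = N2 := by field_simp
    have e2 : (u * w) * (N3 / w) = u * N3 := by field_simp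
    have e3 : 2 * w * (YS1 / w) = 2 * YS1 := by field_simp
    linarith only [h, e1, e2, e3]
  · have e : (w) * (YSq / w) = YSq := by field_simp
    linarith only [o1, e]
  · have e1 : (w) * (YS / w) = YS := by field_simp
    have e2 : (w) * (N2 / w) = N2 := by field_simp
    linarith only [o2, e1, e2]
  · have e1 : (w) * (YSe / w) = YSe := by field_simp
    have e2 : (w) * (N2 / w) = N2 := by field_simp
    linarith only [o3, e1, e2]
  · have e1 : (w) * (YS / w) = YS := by field_simp
    have e2 : (w) * (N3 / w) = N3 := by field_simp
    linarith only [o4, e1, e2]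
  · rw [show (-2) * (YS1 / w) + (1) * (YSq / w) + (1) * (YS / w) = (-2 * YS1 + YSq + YS) / w by ring]
    exact div_nonneg rMC hw0.le
  · rw [show (-2 + 2 * τ) * (YS1 / w) + (1) * (YSe / w) + (1 - 2 * τ) * (YSq / w) =
      ((-2 + 2 * τ) * YS1 + YSe + (1 - 2 * τ) * YSq) / w by ring]
    exact div_nonneg rGC hw0.le

/-- `Φ`, kept set `K ∋ s₁`, complement `C ≠ ∅`: option `2A₁ + 2Y₁`; options `1 + A₀ + Y₀ ≤ N_S`,
`w + A₂ + Y_J ≤ N₂` (`A₂ = BR_X({e-q, -q} ∪ K)`, `Y_J = BR_Y({s₁-q} ∪ C)`), `w + A₃ + Y_J ≤ N₃`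
(`A₃ = BR_X({e-q} ∪ K)`); rows `Φ(K; e)` on `X` and LEMMA B1 on `Y`: (MC) `2Y₁ ≤ Y₀ + Z`, gap
convexity `(2-2w) Y₁ ≤ Y_J + (1-2w) Y₀`, (M) `Z ≤ Y_J`. -/
theorem phiU_top {u w τ NS N2 N3 A1 A0 A2 A3 Y1 Y0 YJ Z : ℚ} (hu0 : 0 < u) (hwu : 4 * u ≤ w)
    (hτw : 2 * w ≤ τ) (hτ4 : τ ≤ 1 / 4) (o1 : 1 + (A0 + Y0) ≤ NS) (o2 : w + (A2 + YJ) ≤ N2)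
    (o3 : w + (A3 + YJ) ≤ N3) (rPhi : 0 ≤ -2 * A1 + (1 - u) * A0 + A2 + u * A3) (rMC : 0 ≤ -2 * Y1 + Y0 + Z)
    (rGC : 0 ≤ (-2 + 2 * w) * Y1 + YJ + (1 - 2 * w) * Y0) (rM : 0 ≤ -Z + YJ) :
    1 + (2 * A1 + 2 * Y1) ≤ (1 - u) * NS + N2 + u * N3 := by
  have hw0 : 0 < w := by linarith
  have hwne : w ≠ 0 := hw0.ne'
  have h := phi3p_branchK (u := u) (m := w) (t := τ) (g := 1 / 2) (NKL := NS) (NP3 := N2 / w) (NPJ := N3 / w)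
    (TCJa := A2 / w) (XCJa := A3 / w) (XK1a := 2 * A1) (XKa := A0) (XQL1b := 2 * Y1 / w) (XQLKb := 2 * YJ / w)
    (XQLb := 2 * Y0 / w) (Zb := 2 * Z / w) hu0 (by linarith) hτw hτ4 (by linarith) ?_ ?_ ?_ ?_ ?_ ?_ ?_
  · have e1 : (w) * (N2 / w) = N2 := by field_simp
    have e2 : (u * w) * (N3 / w) = u * N3 := by field_simp
    have e3 : 2 * (w * (1 / 2)) * (2 * Y1 / w) = 2 * Y1 := by field_simp
    linarith only [h, e1, e2, e3]
  · have e : (w * (1 / 2)) * (2 * Y0 / w) = Y0 := by field_simp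
    linarith only [o1, e]
  · rw [le_div_iff₀ hw0]
    have e : (1 + ((1) * (A2 / w) + (1 / 2) * (2 * YJ / w))) * w = w + (A2 + YJ) := by field_simp
    rw [e]; exact o2
  · rw [le_div_iff₀ hw0]
    have e : (1 + ((1) * (A3 / w) + (1 / 2) * (2 * YJ / w))) * w = w + (A3 + YJ) := by field_simp
    rw [e]; exact o3
  · have e1 : (w) * (A2 / w) = A2 := by field_simp
    have e2 : (u * w) * (A3 / w) = u * A3 := by field_simp
    linarith only [rPhi, e1, e2]
  · rw [show (-2) * (2 * Y1 / w) + (1) * (2 * Y0 / w) + (1) * (2 * Z / w) = 2 * (-2 * Y1 + Y0 + Z) / w by ring]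
    exact div_nonneg (by linarith only [rMC]) hw0.le
  · rw [show (-2 + 2 * w) * (2 * Y1 / w) + (1) * (2 * YJ / w) + (1 - 2 * w) * (2 * Y0 / w) =
      2 * ((-2 + 2 * w) * Y1 + YJ + (1 - 2 * w) * Y0) / w by ring]
    exact div_nonneg (by linarith only [rGC]) hw0.le
  · rw [show (-1) * (2 * Z / w) + (1) * (2 * YJ / w) = 2 * (-Z + YJ) / w by ring]
    exact div_nonneg (by linarith only [rM]) hw0.le

/-- `Φ`, kept set `K` with `s₁ ∉ K ≠ ∅`: option `2A₁ + 2Y₁`; options `1 + A₀ + Y₀ ≤ N_S`,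
`w + Y_E + A_P ≤ N₂` (`Y_E = BR_Y({e-q} ∪ C)`, `A_P = BR_X({s₁-q, -q} ∪ K)`), `w + Y_E + A_J ≤ N₃`
(`A_J = BR_X({s₁-q} ∪ K)`); rows `Φ(K; s₁)` on `X` and LEMMA B1 on `Y`: (MC) `2Y₁ ≤ Y₀ + Z`, gap
convexity `(2-2τ) Y₁ ≤ Y_E + (1-2τ) Y₀`, (M) `Z ≤ Y_E`. -/
theorem phiU_low {u w τ NS N2 N3 A1 A0 AP AJ Y1 Y0 YE Z : ℚ} (hu0 : 0 < u) (hwu : 2 * u ≤ w)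
    (hτw : 2 * w ≤ τ) (hτ4 : τ ≤ 1 / 4) (o1 : 1 + (A0 + Y0) ≤ NS) (o2 : w + (YE + AP) ≤ N2)
    (o3 : w + (YE + AJ) ≤ N3) (rPhi : 0 ≤ -2 * A1 + (1 - u) * A0 + AP + u * AJ) (rMC : 0 ≤ -2 * Y1 + Y0 + Z)
    (rGC : 0 ≤ (-2 + 2 * τ) * Y1 + YE + (1 - 2 * τ) * Y0) (rM : 0 ≤ -Z + YE) :
    1 + (2 * A1 + 2 * Y1) ≤ (1 - u) * NS + N2 + u * N3 := by
  have hw0 : 0 < w := by linarith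
  have hwne : w ≠ 0 := hw0.ne'
  have h := phi3p_branchL (u := u) (m := w) (t := τ) (g := 1) (NKL := NS) (NP3 := N2 / w) (NPJ := N3 / w)
    (TLLa := AP / w) (XC1b := Y1 / w) (XCJb := YE / w) (XCb := Y0 / w) (XL1a := 2 * A1) (XLa := A0)
    (XQLKa := AJ / w) (Zb := Z / w) hu0 hwu hτw hτ4 ?_ ?_ ?_ ?_ ?_ ?_ ?_
  · have e1 : (w) * (N2 / w) = N2 := by field_simp
    have e2 : (u * w) * (N3 / w) = u * N3 := by field_simp
    have e3 : 2 * w * (Y1 / w) = 2 * Y1 := by field_simp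
    linarith only [h, e1, e2, e3]
  · have e : (w) * (Y0 / w) = Y0 := by field_simp
    linarith only [o1, e]
  · rw [le_div_iff₀ hw0]
    have e : (1 + ((1) * (YE / w) + (1) * (AP / w))) * w = w + (YE + AP) := by field_simp
    rw [e]; exact o2
  · rw [le_div_iff₀ hw0]
    have e : (1 + ((1) * (YE / w) + (1) * (AJ / w))) * w = w + (YE + AJ) := by field_simp
    rw [e]; exact o3
  · have e1 : (w * 1) * (AP / w) = AP := by field_simp
    have e2 : (u * w * 1) * (AJ / w) = u * AJ := by field_simp
    linarith only [rPhi, e1, e2]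
  · rw [show (-2) * (Y1 / w) + (1) * (Y0 / w) + (1) * (Z / w) = (-2 * Y1 + Y0 + Z) / w by ring]
    exact div_nonneg rMC hw0.le
  · rw [show (-2 + 2 * τ) * (Y1 / w) + (1) * (YE / w) + (1 - 2 * τ) * (Y0 / w) =
      ((-2 + 2 * τ) * Y1 + YE + (1 - 2 * τ) * Y0) / w by ring]
    exact div_nonneg rGC hw0.le
  · rw [show (-1) * (Z / w) + (1) * (YE / w) = (-Z + YE) / w by ring]
    exact div_nonneg rM hw0.le

end Summit.Ventures.CertifiedArithmetic.LowPrec.Opt
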